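import Literature.IUT.HodgeArakelov.PlusMinusTowerStableCurveBridge
import Literature.IUT.HodgeArakelov.PlusMinusTowerCyclicToy
import HarnessLib

/-!
# [IUTchII] Def. 2.3 (i) / Cor. 2.4: the `ℍ`-dictionary `StableCurveAgreement.SubgraphDictionary A H` is a SCHEMA —
# universal-closure certificate at the cyclic toy tower (proof-only)

S. Mochizuki, *Inter-universal Teichmüller theory II*, kurims manuscript (Dec. 2020), §2, Definition 2.3 (i) p. 67 and Corollary 2.4 (i)
pp. 69–71 (with [IUTchI] Cor. 2.3 p. 47) [claim: Mochizuki2012, status: disputed] (IUTchII §2 Def 2.3 (i) / Cor 2.4, kurims pp.67-71).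
abc-iut cell, D-0079 L-K «cone below S, unconditional», K-L6 slice (abc-iut-w4-d007 gen 10, row «KL6-CLOSURE-CERTS»).  PROOF-ONLY
companion of abc-iut-L6-t7's `PlusMinusTowerStableCurveBridge.lean` over abc-iut-w5-d243's cyclic toy (`PlusMinusTowerCyclicToy.lean`);
no `def`, no `instance`, nothing re-typed.

The frozen FACT-LIST row **F-2734** `PlusMinusTower.StableCurveAgreement.SubgraphDictionary` (label `fact-open`) occurs in HYPOTHESIS
position inside the typed statement of the L6 cone row IUTchII:Cor2.4(ii) (abc-iut-w5-d012 `L6-SLICE-INPUT-CENSUS-v2`, ca24e4516e42b12c) —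
one of the two «fact-open» inputs of the whole L6 certificate.  The tree held instance-form producers (`subgraphDictionary_comap`,
`SubgraphDictionary.of_pi`, the genuine `exists_stableCurveAgreement_piSubgraphDictionary_ofPiCHat_ofSpecialFibre`, abc-iut L6 lineages)
and a CONDITIONAL refuter (abc-iut-w5-d132's `not_forall_subgraphDictionary_of_deltaPmBox_ne`: no single agreement serves two `Π_{v□}`
with different `Δ^±_{v□}`), but no decision of the universal closure.  `A.SubgraphDictionary H` is a predicate on an ARBITRARY
agreement `A : W.StableCurveAgreement C D` between a tower `W` (interface) and a [IUTchI] §2 datum `D` (interface) and an ARBITRARY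
`Π_{v□} = H`: it asserts `Δ^±_{v□} ↦ Δ^tp_{X,ℍ}` under `A.eHat`.  Its right side is FIXED by `D` while its left side moves with `H`,
and the interfaces admit degenerate inhabitants; `not_subgraphDictionary_of_bot` isolates the failure («`Π^tp_ℍ = 1` with
`Δ^tp_X ↪ Π^tp_𝔾`, but `Δ^±_{v□} ≠ 1`») and `exists_stableCurveAgreement_not_subgraphDictionary` realises it at abc-iut-w5-d243's
cyclic toy tower (`l = 3`, `p = 5`: `Π̂^cor_v = ℤ/2 × ℤ/3 × ℤ/3`, `Π̂^±_v = Π^±_v = ℤ/3`, `Π_v = 1`, `G_v = 1`) with the [IUTchI] §2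
datum `Π^tp_X = Π̂_X = Π^tp_𝔾 = Π̂_𝔾 := Π̂^±_v`, `Π^tp_ℍ := 1`, `Π̂_ℍ := Π̂_𝔾`, one cusp with trivial inertia, and the agreement
`eHat := id` (cuspidal-inertia predicate: «the trivial subgroup», matched by `inertia_iff`).  At `Π_{v□} := Π_v` one has
`Δ^±_{v□} = N_{Π^±_v}(Π_v) = Π^±_v = ℤ/3 ≠ 1 = Δ^tp_{X,ℍ}`.  Hence the CLOSED certificate `not_forall_subgraphDictionary`: the
universal closure of F-2734 is FALSE; the row is consumable only in instance form at the genuine agreement (FACT-LIST class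
«universal-closure REFUTED / schema; instance forms …»).

HONEST FRAMING: a refuted universal closure is a statement about OUR typing (the interface records admit degenerate inhabitants —
finite groups, a vacuous inertia predicate, `Π̂_ℍ` unrelated to `Π^tp_ℍ`), not about the printed definition/corollary (genuine
decomposition groups of the subgraphs `Γ_{•t}`, `Γ^▶_X`); nothing here bears on [IUTchIII] Cor. 3.12 or takes a side; typed ≠ proved;
nothing asserts abc proved or refuted.
-/

noncomputable section

namespace Literature.IUT.HodgeArakelov

open Multiplicative Literature.IUT.HodgeTheaters
open scoped Pointwise

universe u

namespace PlusMinusTower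

namespace StableCurveAgreement

variable {S : BadPlaceSetting.{u}} {P : TopGroup.{u}} {T : TemperedCoverings S P}
  {W : PlusMinusTower T} {C : CuspidalInertiaData W} {D : StableCurveTemperedData.{u}}

/-- **IUTchII:Def2.3(i)** (kurims p.67) WHICH degeneration kills the `ℍ`-dictionary: if the [IUTchI] §2 datum has `Π^tp_ℍ = 1` and
`Δ^tp_X ↪ Π^tp_𝔾` injective (so `Δ^tp_{X,ℍ} = 1`), then NO agreement carries a dictionary for a `Π_{v□}` whose `Δ^±_{v□}` contains a
non-trivial element of `Π̂^±_v`. [claim: Mochizuki2012, status: disputed] (IUTchII §2 Def 2.3 (i), kurims p.67) -/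
theorem not_subgraphDictionary_of_bot (A : W.StableCurveAgreement C D) (hT : D.graph.TpH = ⊥)
    (hρ : Function.Injective D.ρTp) {H : Subgroup P} {γ : W.Corhat} (hγ : γ ∈ W.deltaPmBox H) (hγpm : γ ∈ W.pmHat)
    (hγ1 : γ ≠ 1) : ¬ A.SubgraphDictionary H := by
  intro h
  have h1 : D.deltaTpH = ⊥ := by
    rw [StableCurveTemperedData.deltaTpH, hT, MonoidHom.comap_bot, MonoidHom.ker_eq_bot_iff]
    exact hρ
  have key := h.deltaPmBox_eq
  rw [h1, Subgroup.map_bot, Subgroup.map_bot] at key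
  have hmem : A.eHat.toMonoidHom ⟨γ, hγpm⟩ ∈ ((W.deltaPmBox H).subgroupOf W.pmHat).map A.eHat.toMonoidHom :=
    Subgroup.mem_map_of_mem _ (Subgroup.mem_subgroupOf.mpr hγ)
  rw [key, Subgroup.mem_bot, MulEquiv.coe_toMonoidHom, map_eq_one_iff _ A.eHat.injective] at hmem
  exact hγ1 (congrArg Subtype.val hmem)

end StableCurveAgreement

end PlusMinusTower

/-! ## The degenerate agreement over the cyclic toy tower and the closed certificate -/

/-- **IUTchII:Def2.3(i)** / **Cor2.4(i)** (kurims pp.67-71) Over abc-iut-w5-d243's cyclic toy tower (`l = 3`, `p = 5`) there are a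
[IUTchI] §2 datum `D` (`Π^tp_X = Π̂_X = Π^tp_𝔾 = Π̂_𝔾 := Π̂^±_v = ℤ/3`, `G_k = 1`, `Π^tp_ℍ := 1`, `Π̂_ℍ := ℤ/3`, one cusp with trivial
inertia), a cuspidal-inertia predicate `C` («the trivial subgroup») and an agreement `A` (`eHat := id`) for which the `ℍ`-dictionary
FAILS at `Π_{v□} := Π_v`: `Δ^±_{v□} = Π^±_v = ℤ/3` while `Δ^tp_{X,ℍ} = 1`. [claim: Mochizuki2012, status: disputed] (IUTchII §2 Def 2.3 (i), kurims p.67) -/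
theorem exists_stableCurveAgreement_not_subgraphDictionary :
    ∃ (D : StableCurveTemperedData.{0})
      (C : CuspidalInertiaData (CyclicToy.cyclicTower 3 5 Nat.prime_three (by decide) Nat.prime_five (by decide) (by decide)))
      (A : (CyclicToy.cyclicTower 3 5 Nat.prime_three (by decide) Nat.prime_five (by decide) (by decide)).StableCurveAgreement
        C D), ¬ A.SubgraphDictionary ⊤ := by
  haveI : Fact (1 < 3) := ⟨by decide⟩
  set W := CyclicToy.cyclicTower 3 5 Nat.prime_three (by decide) Nat.prime_five (by decide) (by decide) with hW
  -- the [IUTchI] §2 datum: everything `:= Π̂^±_v = ℤ/3`, `Π^tp_ℍ := 1`, `Π̂_ℍ := ⊤`, one cusp with trivial inertia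
  let G : TemperedGraphGroupData.{0} :=
    { Sigma := {3}
      SigmaHat := {3}
      sigma_subset := le_rfl
      sigma_nonempty := ⟨3, rfl⟩
      sigmaHat_prime := by
        intro q hq
        rw [Set.mem_singleton_iff] at hq
        subst hq
        exact Nat.prime_three
      Tp := ↥(CyclicToy.Hpm 3)
      Hat := ↥(CyclicToy.Hpm 3)
      ι := MonoidHom.id _
      ι_continuous := continuous_id
      ι_injective := fun _ _ h => h
      TpH := ⊥
      HatH := ⊤
      tpH_le := le_top }
  let D : StableCurveTemperedData.{0} :=
    { graph := G
      p := 5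
      p_notMem := by
        show (5 : ℕ) ∉ ({3} : Set ℕ)
        simp
      PiTp := ↥(CyclicToy.Hpm 3)
      PiHat := ↥(CyclicToy.Hpm 3)
      Gk := Multiplicative (ZMod 1)
      ιX := MonoidHom.id _
      ιX_continuous := continuous_id
      ιX_injective := fun _ _ h => h
      prTp := 1
      prHat := 1
      prTp_surjective := fun _ => ⟨1, Subsingleton.elim _ _⟩
      prHat_comp := by ext; exact Subsingleton.elim _ _
      ρTp := (1 : ↥(CyclicToy.Hpm 3) →* Multiplicative (ZMod 1)).ker.subtype
      ρHat := (1 : ↥(CyclicToy.Hpm 3) →* Multiplicative (ZMod 1)).ker.subtype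
      ρTp_surjective := fun x => ⟨⟨x, by simp⟩, rfl⟩
      ρHat_surjective := fun x => ⟨⟨x, by simp⟩, rfl⟩
      ρ_comp := fun _ => rfl
      Cusp := PUnit
      inertiaTp := fun _ => ⊥
      cuspMeetsH := fun _ => True
      Pt := PUnit
      decompTp := fun _ => ⊤ }
  -- the vacuous cuspidal-inertia predicate: exactly the trivial subgroup
  let C : CuspidalInertiaData W :=
    { IsCuspidalInertia := fun _ I => I = ⊥
      le_of_isCuspidalInertia := by
        intro Q I h
        rw [h]
        exact bot_le }
  -- `Π^±_v ⊆ Π̂^±_v` (here an equality of finite groups)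
  have hpiPM : ∀ y : ↥(CyclicToy.Hpm 3), (y : CyclicToy.Amb 3) ∈ W.piPM := fun y => ⟨y, rfl⟩
  -- the agreement `eHat := id`
  let A : W.StableCurveAgreement C D :=
    { eHat := MulEquiv.refl _
      map_piPM := by
        apply le_antisymm
        · intro y _
          exact ⟨y, rfl⟩
        · intro y _
          exact ⟨y, Subgroup.mem_subgroupOf.mpr (hpiPM y), rfl⟩
      mem_ker_iff := fun g =>
        ⟨fun _ => MonoidHom.mem_ker.mpr (Subsingleton.elim _ _), fun _ => MonoidHom.mem_ker.mpr (Subsingleton.elim _ _)⟩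
      inertia_iff := by
        intro I
        constructor
        · intro hI
          change I = ⊥ at hI
          subst hI
          refine ⟨bot_le, PUnit.unit, 1, ?_⟩
          rw [Subgroup.bot_subgroupOf, Subgroup.map_bot, Subgroup.map_bot, Subgroup.smul_bot, Subgroup.map_bot]
        · rintro ⟨hle, x, t, heq⟩
          rw [Subgroup.map_bot, Subgroup.smul_bot, Subgroup.map_bot] at heq
          show I = ⊥
          rw [eq_bot_iff]
          intro y hy
          have hy' : (⟨y, W.emb_le_pmHat (hle hy)⟩ : ↥W.pmHat) ∈ I.subgroupOf W.pmHat :=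
            Subgroup.mem_subgroupOf.mpr hy
          have hmem := Subgroup.mem_map_of_mem (MulEquiv.refl (↥W.pmHat)).toMonoidHom hy'
          rw [heq, Subgroup.mem_bot] at hmem
          exact Subgroup.mem_bot.mpr (congrArg Subtype.val hmem) }
  refine ⟨D, C, A, ?_⟩
  -- `γ := (0,0,1) ∈ Π^±_v = Π̂^±_v`, non-trivial, lies in `Δ^±_{v□} = N_{Π^±_v}(Π_v) ∩ Δ̂^cor_v` for `Π_{v□} := Π_v`
  have hγpm : CyclicToy.ιpm 3 (ofAdd 1) ∈ W.pmHat := ⟨ofAdd 1, rfl⟩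
  have hγ1 : CyclicToy.ιpm 3 (ofAdd 1) ≠ 1 := by
    intro h
    have h2 := congrArg (fun x : CyclicToy.Amb 3 => (toAdd x).2.2) h
    simp [CyclicToy.ιpm] at h2
  have hγ : CyclicToy.ιpm 3 (ofAdd 1) ∈ W.deltaPmBox ⊤ := by
    refine Subgroup.mem_inf.mpr ⟨?_, MonoidHom.mem_ker.mpr (Subsingleton.elim _ _)⟩
    -- membership in `N_{Π^±_v}(Π_{v□})`: `Π^±_v` is commutative, so every element normalises every subset
    refine ⟨⟨CyclicToy.ιpm 3 (ofAdd 1), hpiPM ⟨_, hγpm⟩⟩, ?_, rfl⟩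
    refine Subgroup.mem_set_normalizer_iff.mpr fun n => ?_
    rw [mul_inv_cancel_comm]
  refine PlusMinusTower.StableCurveAgreement.not_subgraphDictionary_of_bot A rfl Subtype.val_injective hγ hγpm hγ1

/-- **F-2734 is a schema**: the universal closure of `PlusMinusTower.StableCurveAgreement.SubgraphDictionary` (over all settings,
coverings, towers, cuspidal-inertia predicates, [IUTchI] §2 data, agreements and `Π_{v□}`) is FALSE; the instance forms the cone
uses are `subgraphDictionary_comap` / `SubgraphDictionary.of_pi` / `exists_stableCurveAgreement_piSubgraphDictionary_ofPiCHat_ofSpecialFibre`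
(genuine agreement, BY NAME). [claim: Mochizuki2012, status: disputed] (IUTchII §2 Def 2.3 (i), kurims p.67) -/
theorem not_forall_subgraphDictionary :
    ¬ ∀ (S : BadPlaceSetting.{0}) (P : TopGroup.{0}) (T : TemperedCoverings S P) (W : PlusMinusTower T)
        (C : CuspidalInertiaData W) (D : StableCurveTemperedData.{0}) (A : W.StableCurveAgreement C D) (H : Subgroup P),
        A.SubgraphDictionary H := by
  intro h
  obtain ⟨D, C, A, hA⟩ := exists_stableCurveAgreement_not_subgraphDictionary
  exact hA (h _ _ _ _ C D A ⊤)

end Literature.IUT.HodgeArakelov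

end
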